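/-
Copyright (c) 2026 the pub-hodgecm-mathlib formalisation cell (harness21).  Prover seat hodgecm-mathlib-LH4-p12 (g0), Track A «FOUR-FRAME», unit U2H_HSide,
(ρ)-child (b′) «ROW (1) H-SIDE DEPTH IDENTITY», dictionary bricks (b′-2)∕(b′-4) SECOND SEAT (dealer LH4-plan (g10) WORD #47∕#48): THE TYPE-(1) DEPTH LAW.  2026-09-03.
-/
import Literature.NumberTheory.Automorphic.UnitaryThreeFourFrameDefs      -- ★ #0a DEFS-1 (B-p04): `IsRamifiedQuadraticDatum σ ϖ d t` (the place datum of record)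
import HarnessLib

/-!
# F0 · P3c · line «(D-RAM) FOUR-FRAME» — U2H (b′) dictionary: THE DEPTH LAW `N = 2n + d` OF A TYPE-(1) TORUS ELEMENT AT A RAMIFIED PLACE

Cell `pub/hodgecm-mathlib`, crux H413 = `stmt-HodgeConjecture-24833` (helper lane `--supports stmt-HodgeConjecture-24833 --as helper`), route
HCCMUnconditional.  Pure valuation algebra in the currency of the place datum of record ★ `IsRamifiedQuadraticDatum σ ϖ d t` on the local CM
completion `K = E = L_w` (`σ` the conjugation of `E ∕ F`, `F = L⁺_v = K^σ`, `ϖ` a uniformiser of `E`, `d = v_E(ϖ − σϖ)` the different exponent,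
`t = v_E(2)`); any residue characteristic, both wild types, no `σϖ = −ϖ`, no `|2| = 1`.

THE DICTIONARY QUESTION (dealer WORD #47; (ρ) child (b′) target `Σ_s coef_s·Φ^st(γ_H, hFamily s) = C·4·max 0 (q^{(n₃+2−d)∕2} − q^{shiftR d t_E})∕(q−1)`).
A type-(1) elliptic `γ₂ ∈ U(Φ₂)(F_v)` with eigenvalues `e₁, e₂ ∈ E¹` descends (★ `exists_conj_diagonal_eq_smul_map_toPlace`, ★ p855257, LH4-p13's ★ #10
`SLTwoTreeQuadraticTorusNormalForm`) to the class in `PGL₂(F)` of an element `ζ = x + z·τ ∈ E^×` (`x, z ∈ F`, `τ` a uniformiser of `E`, Eisenstein datum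
`(u, v) = (τ + στ, −τστ)`), with `e₁ ∕ e₂ = ζ ∕ σζ`; the H-side count of (b′) is the edge-ball of the `SL₂(F)`-tree of radius `n = v_F(b)`, `b = z ∕ x`
(★ p855257: `(q−1)·#V + 2 = 2q^{n+1}`).  This file relates `n` to the ROW DEPTH `N = n₃ = v_E(e₁ − e₂)`, taking `τ := ϖ` (the datum's uniformiser):

* §1 `v_E(ζ − σζ) = |z|·|ϖ|^d` (`ζ − σζ = z(ϖ − σϖ)`), and the two cases of `|ζ|`: VERTEX TYPE `|z| ≤ |x|` ⇒ `|ζ| = |x|`; EDGE TYPE `|x| < |z|` ⇒ `|ζ| = |z|·|ϖ|`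
  (parities: `σ`-fixed elements have even valuation).
* §2 the law in ratio currency: vertex `|ζ∕σζ − 1| = (|z|∕|x|)·|ϖ|^d`, edge `|ζ∕σζ − 1| = |ϖ|^{d−1}`; and the SHARP VERTEX CRITERION
  `|z| ≤ |x| ⟺ |ζ∕σζ − 1| ≤ |ϖ|^d` (depth `≥ d`; replaces the sufficient-only «deep» hypothesis `|t² − 4 det| < |u² + 4v|·|t|²`, which at a dyadic place
  misses every vertex-type element with `v_F(b) ≤ v_F(2)`).
* §3 eigenvalue currency, torus form `a = 1` (`x = 1`, `z = b ∈ 𝒪_F`, the binders of ★ p855257 ∕ ★ #10 §3): from `e₁·(1 + b·σϖ) = e₂·(1 + b·ϖ)`, `|e₂| = 1`: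
  **`|e₁ − e₂| = |b|·|ϖ|^d`**, hence with `|b|_E = |ϖ|^{2n}` (i.e. `|b|_F = |ϖ_F|^n`): **`|e₁ − e₂| = |ϖ|^{2n+d}`, `N = 2n + d`, `d ≤ N`, `N ≡ d (mod 2)`** —
  so the target's radius exponent `(n₃ + 2 − d)∕2` is `n + 1` on the nose.
* §4 the edge twin `N = d − 1` and the DICHOTOMY: every depth `N` of a type-(1) element is `d − 1` (edge type: no fixed vertex, one fixed geometric edge) or
  `2n + d` (vertex type: edge-ball of radius `n`); in particular `d ≤ N ⇒` vertex type.

HONEST LABEL: HC_CM is proved only modulo the 7 printed citations (2 remaining named inputs: hLiu418 = stmt-HodgeConjecture-24832, h413 =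
stmt-HodgeConjecture-24833) until rung 0 closes; count-neutral helper.

## References
* [LabesseLanglands1979] J.-P. Labesse, R. P. Langlands, *L-indistinguishability for SL(2)*, Canad. J. Math. 31 (1979), §2 pp. 7–8 (the ramified torus
  `T ⊂ SL₂`, its filtration and the fixed balls in the tree).
* [Serre1979] J.-P. Serre, *Local Fields*, GTM 67: Ch. III §6 Cor. 2 (different of an Eisenstein generator `= f′(π) = π − σπ`), Ch. IV §1–§2.
* [Rogawski1990] J. D. Rogawski, *Automorphic Representations of Unitary Groups in Three Variables*, §4.9 Prop. 4.9.1 p. 55 (the H-side census).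
* [Serre1980Trees] J.-P. Serre, *Trees*, Ch. II §1.1–§1.3 (vertices and edges of the tree of `SL₂` over a local field; inversions).
-/

noncomputable section

open scoped Valued WithZero

namespace Summit.HodgeConjecture.HodgeConjecture.Cruxes.H413.F0P3cDyRamTypeOneDepthLaw

open Literature.NumberTheory.Automorphic Literature.NumberTheory.Automorphic.UnitaryThreeFourFrame

variable {K : Type} [Field K] [Valued K ℤᵐ⁰] {σ : K →+* K} {ϖ : K} {d t : ℕ}

/-! ## §0 Exponent bookkeeping -/

/-- `|ϖ|^k = exp(−k)` for the datum's uniformiser (`|ϖ| = exp(−1)`). [cite: Serre1979, Ch. I §1] -/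
theorem valuation_pow_eq_exp (hϖ : Valued.v ϖ = WithZero.exp (-1 : ℤ)) (k : ℕ) :
    Valued.v ϖ ^ k = WithZero.exp (-(k : ℤ)) := by
  rw [hϖ, ← WithZero.exp_nsmul, nsmul_eq_mul, mul_neg, mul_one]

/-- Powers of `|ϖ|` are injective in the exponent. [cite: Serre1979, Ch. I §1] -/
theorem eq_of_valuation_pow_eq (hϖ : Valued.v ϖ = WithZero.exp (-1 : ℤ)) {a b : ℕ} (h : Valued.v ϖ ^ a = Valued.v ϖ ^ b) : a = b := by
  rw [valuation_pow_eq_exp hϖ, valuation_pow_eq_exp hϖ] at h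
  have := WithZero.exp_injective h
  omega

/-- `|ϖ| < 1`. [cite: Serre1979, Ch. I §1] -/
theorem valuation_lt_one (hϖ : Valued.v ϖ = WithZero.exp (-1 : ℤ)) : Valued.v ϖ < 1 := by
  rw [hϖ, ← WithZero.exp_zero]
  exact WithZero.exp_lt_exp.2 (by norm_num)

/-- A `σ`-fixed non-zero element of valuation `≤ 1` has valuation `|ϖ|^{2n}` for some `n ∈ ℕ` (ramified: `F`-elements have even `E`-valuation).
This is the binder `hbn` of the census depth. [cite: Serre1979, Ch. I §6; Ch. IV §1] -/
theorem exists_valuation_eq_pow_two_mul (hD : IsRamifiedQuadraticDatum σ ϖ d t) {b : K} (hb : σ b = b) (hb0 : b ≠ 0)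
    (hb1 : Valued.v b ≤ 1) : ∃ n : ℕ, Valued.v b = Valued.v ϖ ^ (2 * n) := by
  obtain ⟨-, -, hϖ, heven, -, -, -⟩ := hD
  obtain ⟨m, hm⟩ := heven b hb hb0
  have hm0 : m ≤ 0 := by
    rw [hm, ← WithZero.exp_zero] at hb1
    have := WithZero.exp_le_exp.1 hb1
    omega
  refine ⟨(-m).toNat, ?_⟩
  rw [hm, valuation_pow_eq_exp hϖ]
  congr 1
  push_cast
  rw [Int.toNat_of_nonneg (by omega)]
  ring

/-! ## §1 The element `ζ = x + z·ϖ` (`x, z ∈ F`): skew part and the two size cases -/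

omit [Valued K ℤᵐ⁰] in
/-- `σ(x + zϖ) = x + z·σϖ` for `σ`-fixed `x, z`. [cite: LabesseLanglands1979, §2 p. 7] -/
theorem map_add_mul_eq {x z : K} (hx : σ x = x) (hz : σ z = z) : σ (x + z * ϖ) = x + z * σ ϖ := by
  rw [map_add, map_mul, hx, hz]

omit [Valued K ℤᵐ⁰] in
/-- SKEW PART: `ζ − σζ = z·(ϖ − σϖ)`. [cite: LabesseLanglands1979, §2 p. 7] -/
theorem sub_map_eq_mul {x z : K} (hx : σ x = x) (hz : σ z = z) : (x + z * ϖ) - σ (x + z * ϖ) = z * (ϖ - σ ϖ) := by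
  rw [map_add_mul_eq hx hz]
  ring

/-- `|ζ − σζ| = |z|·|ϖ|^d` (`d` = the different exponent of the datum). [cite: Serre1979, Ch. III §6 Cor. 2] [cite: LabesseLanglands1979, §2 p. 8] -/
theorem valuation_sub_map_eq (hD : IsRamifiedQuadraticDatum σ ϖ d t) {x z : K} (hx : σ x = x) (hz : σ z = z) :
    Valued.v ((x + z * ϖ) - σ (x + z * ϖ)) = Valued.v z * Valued.v ϖ ^ d := by
  rw [sub_map_eq_mul hx hz, map_mul, hD.2.2.2.2.1]

/-- VERTEX TYPE: `|z| ≤ |x|`, `x ≠ 0` ⇒ `|x + zϖ| = |x|`. [cite: LabesseLanglands1979, §2 p. 8] -/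
theorem valuation_add_mul_eq_of_le (hD : IsRamifiedQuadraticDatum σ ϖ d t) {x z : K} (hx0 : x ≠ 0)
    (hzx : Valued.v z ≤ Valued.v x) : Valued.v (x + z * ϖ) = Valued.v x := by
  have hϖ := hD.2.2.1
  have hlt : Valued.v (z * ϖ) < Valued.v x := by
    rcases eq_or_ne z 0 with rfl | hz0
    · rw [zero_mul, map_zero]
      exact zero_lt_iff.2 ((Valuation.ne_zero_iff _).2 hx0)
    · have h1 : Valued.v (z * ϖ) < Valued.v z := by
        rw [map_mul, mul_comm]
        calc Valued.v ϖ * Valued.v z < 1 * Valued.v z :=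
              mul_lt_mul_of_pos_right (valuation_lt_one hϖ) (zero_lt_iff.2 ((Valuation.ne_zero_iff _).2 hz0))
          _ = Valued.v z := one_mul _
      exact lt_of_lt_of_le h1 hzx
  exact Valuation.map_add_eq_of_lt_left _ hlt

/-- EDGE TYPE: `|x| < |z|` (both `σ`-fixed) ⇒ `|x + zϖ| = |z|·|ϖ|` — parities force `|x| < |zϖ|`. [cite: LabesseLanglands1979, §2 p. 8] [cite: Serre1980Trees, Ch. II §1.3] -/
theorem valuation_add_mul_eq_of_lt (hD : IsRamifiedQuadraticDatum σ ϖ d t) {x z : K} (hx : σ x = x) (hz : σ z = z)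
    (hxz : Valued.v x < Valued.v z) : Valued.v (x + z * ϖ) = Valued.v z * Valued.v ϖ := by
  obtain ⟨-, -, hϖ, heven, -, -, -⟩ := hD
  have hz0 : z ≠ 0 := by
    rintro rfl
    rw [map_zero] at hxz
    exact not_lt_zero hxz
  have key : Valued.v x < Valued.v (z * ϖ) := by
    rcases eq_or_ne x 0 with rfl | hx0
    · rw [map_zero]
      exact zero_lt_iff.2 ((Valuation.ne_zero_iff _).2 (mul_ne_zero hz0 (CartanUnique.uniformizer_ne_zero hϖ)))
    · obtain ⟨a, ha⟩ := heven x hx hx0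
      obtain ⟨b, hb⟩ := heven z hz hz0
      have hab : a < b := by
        rw [ha, hb] at hxz
        have := WithZero.exp_lt_exp.1 hxz
        omega
      rw [map_mul, ha, hb, hϖ, ← WithZero.exp_add]
      exact WithZero.exp_lt_exp.2 (by omega)
  rw [Valuation.map_add_eq_of_lt_right _ key, map_mul]

/-! ## §2 The law in ratio currency and the sharp vertex criterion -/

/-- VERTEX TYPE, RATIO FORM: `|ζ∕σζ − 1| = (|z|∕|x|)·|ϖ|^d` for `ζ = x + zϖ`, `|z| ≤ |x|`, `x ≠ 0`. [cite: LabesseLanglands1979, §2 p. 8] -/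
theorem valuation_div_map_sub_one_of_le (hD : IsRamifiedQuadraticDatum σ ϖ d t) {x z : K} (hx : σ x = x) (hz : σ z = z)
    (hx0 : x ≠ 0) (hzx : Valued.v z ≤ Valued.v x) :
    Valued.v ((x + z * ϖ) / σ (x + z * ϖ) - 1) = Valued.v z / Valued.v x * Valued.v ϖ ^ d := by
  have hσv := hD.2.1
  have hvσζ : Valued.v (σ (x + z * ϖ)) = Valued.v x := by rw [hσv, valuation_add_mul_eq_of_le hD hx0 hzx]
  have hσζ0 : σ (x + z * ϖ) ≠ 0 := fun h => hx0 ((Valuation.zero_iff _).1 (by rw [← hvσζ, h, map_zero]))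
  rw [div_sub_one hσζ0, map_div₀, valuation_sub_map_eq hD hx hz, hvσζ, div_eq_mul_inv, div_eq_mul_inv, mul_right_comm]

/-- EDGE TYPE, RATIO FORM: `|ζ∕σζ − 1| = |ϖ|^{d−1}` for `ζ = x + zϖ`, `|x| < |z|`. [cite: LabesseLanglands1979, §2 p. 8] -/
theorem valuation_div_map_sub_one_of_lt (hD : IsRamifiedQuadraticDatum σ ϖ d t) {x z : K} (hx : σ x = x) (hz : σ z = z)
    (hxz : Valued.v x < Valued.v z) :
    Valued.v ((x + z * ϖ) / σ (x + z * ϖ) - 1) = Valued.v ϖ ^ (d - 1) := by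
  have hσv := hD.2.1
  have hϖ := hD.2.2.1
  obtain ⟨e, rfl⟩ : ∃ e, d = e + 1 := ⟨d - 1, by have := hD.2.2.2.2.2.1; omega⟩
  have hz0 : z ≠ 0 := by
    rintro rfl
    rw [map_zero] at hxz
    exact not_lt_zero hxz
  have hvζ := valuation_add_mul_eq_of_lt hD hx hz hxz
  have hvσζ : Valued.v (σ (x + z * ϖ)) = Valued.v z * Valued.v ϖ := by rw [hσv, hvζ]
  have hvz0 : Valued.v z ≠ 0 := (Valuation.ne_zero_iff _).2 hz0
  have hvϖ0 : Valued.v ϖ ≠ 0 := (Valuation.ne_zero_iff _).2 (CartanUnique.uniformizer_ne_zero hϖ)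
  have hσζ0 : σ (x + z * ϖ) ≠ 0 := fun h => by
    rw [h, map_zero] at hvσζ
    exact mul_ne_zero hvz0 hvϖ0 hvσζ.symm
  rw [div_sub_one hσζ0, map_div₀, valuation_sub_map_eq hD hx hz, hvσζ, Nat.add_sub_cancel, pow_succ,
    ← mul_assoc, mul_comm (Valued.v z) (Valued.v ϖ ^ e), mul_assoc, mul_div_assoc, div_self (mul_ne_zero hvz0 hvϖ0), mul_one]

/-- **SHARP VERTEX CRITERION** (depth `≥ d`): for `ζ = x + zϖ ≠ 0` with `x, z ∈ F`, `|z| ≤ |x| ⟺ |ζ∕σζ − 1| ≤ |ϖ|^d`.  The «deep» hypothesis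
`|tr² − 4 det| < |u² + 4v|·|tr|²` of the `(t, d)` normal form is sufficient only; this one is an equivalence. [cite: LabesseLanglands1979, §2 p. 8] -/
theorem valuation_le_iff_valuation_div_map_sub_one_le (hD : IsRamifiedQuadraticDatum σ ϖ d t) {x z : K} (hx : σ x = x) (hz : σ z = z)
    (h0 : x ≠ 0 ∨ z ≠ 0) :
    Valued.v z ≤ Valued.v x ↔ Valued.v ((x + z * ϖ) / σ (x + z * ϖ) - 1) ≤ Valued.v ϖ ^ d := by
  have hϖ := hD.2.2.1
  constructor
  · intro hzx
    have hx0 : x ≠ 0 := by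
      rcases h0 with hx0 | hz0
      · exact hx0
      · intro hx0
        rw [hx0, map_zero] at hzx
        exact hz0 ((Valuation.zero_iff _).1 (le_antisymm hzx zero_le))
    rw [valuation_div_map_sub_one_of_le hD hx hz hx0 hzx]
    calc Valued.v z / Valued.v x * Valued.v ϖ ^ d ≤ 1 * Valued.v ϖ ^ d :=
          mul_le_mul' (div_le_one_of_le₀ hzx zero_le) le_rfl
      _ = Valued.v ϖ ^ d := one_mul _
  · intro hle
    by_contra hzx
    rw [not_le] at hzx
    rw [valuation_div_map_sub_one_of_lt hD hx hz hzx] at hle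
    obtain ⟨e, rfl⟩ : ∃ e, d = e + 1 := ⟨d - 1, by have := hD.2.2.2.2.2.1; omega⟩
    rw [Nat.add_sub_cancel, valuation_pow_eq_exp hϖ, valuation_pow_eq_exp hϖ] at hle
    have := WithZero.exp_le_exp.1 hle
    push_cast at this
    omega

/-! ## §3 Eigenvalue currency — the torus form `a = 1` (`x = 1`, `z = b`): `|e₁ − e₂| = |b|·|ϖ|^d`, `N = 2n + d` -/

/-- From `e₁·ζ′ = e₂·ζ` (`ζ′, e₂ ≠ 0`): `|e₁ − e₂| = |e₂|·|ζ∕ζ′ − 1|`. [cite: Rogawski1990, §4.9 p. 55] -/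
theorem valuation_sub_eq_mul_of_ratio {e₁ e₂ ζ ζ' : K} (hζ' : ζ' ≠ 0) (hratio : e₁ * ζ' = e₂ * ζ) :
    Valued.v (e₁ - e₂) = Valued.v e₂ * Valued.v (ζ / ζ' - 1) := by
  have h : e₁ - e₂ = e₂ * (ζ / ζ' - 1) := by
    field_simp
    linear_combination hratio
  rw [h, map_mul]

/-- **THE DEPTH LAW, TORUS FORM `a = 1`.**  At a ramified quadratic datum `(σ, ϖ, d, t)`: if `b ∈ F` (`σb = b`), `|b| ≤ 1`, `|e₂| = 1` and the eigenvalue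
ratio is that of the torus element `1 + bϖ`, i.e. `e₁·(1 + b·σϖ) = e₂·(1 + b·ϖ)`, then **`|e₁ − e₂| = |b|·|ϖ|^d`**.
(`1 + bϖ`, `1 + bσϖ` are the eigenvalues of the torus form `!![1, b·v; b, 1 + b·u]`, `(u, v) = (ϖ + σϖ, −ϖσϖ)`.)
[cite: LabesseLanglands1979, §2 p. 8] [cite: Rogawski1990, §4.9 Prop. 4.9.1 p. 55] -/
theorem valuation_eigen_sub_eq_of_torusFormOne (hD : IsRamifiedQuadraticDatum σ ϖ d t) {b e₁ e₂ : K} (hb : σ b = b)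
    (hb1 : Valued.v b ≤ 1) (he₂ : Valued.v e₂ = 1) (hratio : e₁ * (1 + b * σ ϖ) = e₂ * (1 + b * ϖ)) :
    Valued.v (e₁ - e₂) = Valued.v b * Valued.v ϖ ^ d := by
  have hσ1 : σ (1 : K) = 1 := map_one σ
  have hb1' : Valued.v b ≤ Valued.v (1 : K) := by rwa [map_one]
  have key := valuation_div_map_sub_one_of_le hD hσ1 hb one_ne_zero hb1'
  rw [map_one, div_one] at key
  have hvσζ : Valued.v (σ (1 + b * ϖ)) = 1 := by
    rw [hD.2.1, valuation_add_mul_eq_of_le hD one_ne_zero hb1', map_one]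
  have hσζ0 : σ (1 + b * ϖ) ≠ 0 := fun h => by
    rw [h, map_zero] at hvσζ
    exact zero_ne_one hvσζ
  have hratio' : e₁ * σ (1 + b * ϖ) = e₂ * (1 + b * ϖ) := by rwa [map_add_mul_eq hσ1 hb]
  rw [valuation_sub_eq_mul_of_ratio hσζ0 hratio', he₂, one_mul, key]

/-- **`N = 2n + d` (valuation form).**  With the census depth binder `|b| = |ϖ|^{2n}` (i.e. `|b|_F = |ϖ_F|^n`): `|e₁ − e₂| = |ϖ|^{2n + d}`.
[cite: LabesseLanglands1979, §2 p. 8] [cite: Rogawski1990, §4.9 Prop. 4.9.1 p. 55] -/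
theorem valuation_eigen_sub_eq_pow (hD : IsRamifiedQuadraticDatum σ ϖ d t) {b e₁ e₂ : K} (hb : σ b = b) {n : ℕ}
    (hbn : Valued.v b = Valued.v ϖ ^ (2 * n)) (he₂ : Valued.v e₂ = 1) (hratio : e₁ * (1 + b * σ ϖ) = e₂ * (1 + b * ϖ)) :
    Valued.v (e₁ - e₂) = Valued.v ϖ ^ (2 * n + d) := by
  have hb1 : Valued.v b ≤ 1 := by
    rw [hbn]
    exact pow_le_one₀ zero_le (valuation_lt_one hD.2.2.1).le
  rw [valuation_eigen_sub_eq_of_torusFormOne hD hb hb1 he₂ hratio, hbn, pow_add]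

/-- **`N = 2n + d` (exponent form)**: if moreover `|e₁ − e₂| = |ϖ|^N` (the row depth `n₃`), then `N = 2n + d` — so the radius exponent
`(N + 2 − d) ∕ 2` of the (b′) target is `n + 1` exactly. [cite: LabesseLanglands1979, §2 p. 8] [cite: Rogawski1990, §4.9 Prop. 4.9.1 p. 55] -/
theorem depth_eq_two_mul_add (hD : IsRamifiedQuadraticDatum σ ϖ d t) {b e₁ e₂ : K} (hb : σ b = b) {n : ℕ}
    (hbn : Valued.v b = Valued.v ϖ ^ (2 * n)) (he₂ : Valued.v e₂ = 1) (hratio : e₁ * (1 + b * σ ϖ) = e₂ * (1 + b * ϖ))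
    {N : ℕ} (hN : Valued.v (e₁ - e₂) = Valued.v ϖ ^ N) : N = 2 * n + d :=
  eq_of_valuation_pow_eq hD.2.2.1 (hN.symm.trans (valuation_eigen_sub_eq_pow hD hb hbn he₂ hratio))

/-- **THRESHOLD AND PARITY**: in the situation of `depth_eq_two_mul_add`, `d ≤ N`, `N ≡ d (mod 2)` and `n = (N − d) ∕ 2`.
[cite: LabesseLanglands1979, §2 p. 8] [cite: Serre1979, Ch. V §3] -/
theorem le_depth_and_mod_two_eq (hD : IsRamifiedQuadraticDatum σ ϖ d t) {b e₁ e₂ : K} (hb : σ b = b) {n : ℕ}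
    (hbn : Valued.v b = Valued.v ϖ ^ (2 * n)) (he₂ : Valued.v e₂ = 1) (hratio : e₁ * (1 + b * σ ϖ) = e₂ * (1 + b * ϖ))
    {N : ℕ} (hN : Valued.v (e₁ - e₂) = Valued.v ϖ ^ N) : d ≤ N ∧ N % 2 = d % 2 ∧ n = (N - d) / 2 := by
  have h := depth_eq_two_mul_add hD hb hbn he₂ hratio hN
  refine ⟨by omega, by omega, by omega⟩

/-! ## §4 The edge twin and the dichotomy -/

/-- **EDGE TWIN `N = d − 1`**: for `ζ = x + zϖ` of edge type (`|x| < |z|`), `|e₂| = 1`, `e₁·σζ = e₂·ζ`: `|e₁ − e₂| = |ϖ|^{d−1}` (the element flips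
the central edge of its torus: no fixed vertex, one fixed geometric edge). [cite: LabesseLanglands1979, §2 p. 8] [cite: Serre1980Trees, Ch. II §1.3] -/
theorem valuation_eigen_sub_eq_pow_of_lt (hD : IsRamifiedQuadraticDatum σ ϖ d t) {x z e₁ e₂ : K} (hx : σ x = x) (hz : σ z = z)
    (hxz : Valued.v x < Valued.v z) (he₂ : Valued.v e₂ = 1) (hratio : e₁ * σ (x + z * ϖ) = e₂ * (x + z * ϖ)) :
    Valued.v (e₁ - e₂) = Valued.v ϖ ^ (d - 1) := by
  have hϖ := hD.2.2.1
  have hz0 : z ≠ 0 := by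
    rintro rfl
    rw [map_zero] at hxz
    exact not_lt_zero hxz
  have hvσζ : Valued.v (σ (x + z * ϖ)) = Valued.v z * Valued.v ϖ := by rw [hD.2.1, valuation_add_mul_eq_of_lt hD hx hz hxz]
  have hσζ0 : σ (x + z * ϖ) ≠ 0 := fun h => by
    rw [h, map_zero] at hvσζ
    exact mul_ne_zero ((Valuation.ne_zero_iff _).2 hz0) ((Valuation.ne_zero_iff _).2 (CartanUnique.uniformizer_ne_zero hϖ)) hvσζ.symm
  rw [valuation_sub_eq_mul_of_ratio hσζ0 hratio, he₂, one_mul, valuation_div_map_sub_one_of_lt hD hx hz hxz]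

/-- **VERTEX TWIN, GENERAL `x`**: for `ζ = x + zϖ` of vertex type (`|z| ≤ |x|`, `x ≠ 0`), `|e₂| = 1`, `e₁·σζ = e₂·ζ`:
`|e₁ − e₂| = (|z|∕|x|)·|ϖ|^d`. [cite: LabesseLanglands1979, §2 p. 8] -/
theorem valuation_eigen_sub_eq_of_le (hD : IsRamifiedQuadraticDatum σ ϖ d t) {x z e₁ e₂ : K} (hx : σ x = x) (hz : σ z = z)
    (hx0 : x ≠ 0) (hzx : Valued.v z ≤ Valued.v x) (he₂ : Valued.v e₂ = 1) (hratio : e₁ * σ (x + z * ϖ) = e₂ * (x + z * ϖ)) :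
    Valued.v (e₁ - e₂) = Valued.v z / Valued.v x * Valued.v ϖ ^ d := by
  have hvσζ : Valued.v (σ (x + z * ϖ)) = Valued.v x := by rw [hD.2.1, valuation_add_mul_eq_of_le hD hx0 hzx]
  have hσζ0 : σ (x + z * ϖ) ≠ 0 := fun h => hx0 ((Valuation.zero_iff _).1 (by rw [← hvσζ, h, map_zero]))
  rw [valuation_sub_eq_mul_of_ratio hσζ0 hratio, he₂, one_mul, valuation_div_map_sub_one_of_le hD hx hz hx0 hzx]

/-- **THE DICHOTOMY.**  For `ζ = x + zϖ` (`x, z ∈ F`, `z ≠ 0`), `|e₂| = 1`, `e₁·σζ = e₂·ζ` and a depth `|e₁ − e₂| = |ϖ|^N`: EITHER vertex type with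
`d ≤ N`, `N ≡ d (mod 2)` (and then `|z|∕|x| = |ϖ|^{N − d}`), OR edge type with `N + 1 = d`. [cite: LabesseLanglands1979, §2 p. 8] [cite: Serre1980Trees, Ch. II §1.3] -/
theorem depth_dichotomy (hD : IsRamifiedQuadraticDatum σ ϖ d t) {x z e₁ e₂ : K} (hx : σ x = x) (hz : σ z = z) (hz0 : z ≠ 0)
    (he₂ : Valued.v e₂ = 1) (hratio : e₁ * σ (x + z * ϖ) = e₂ * (x + z * ϖ)) {N : ℕ} (hN : Valued.v (e₁ - e₂) = Valued.v ϖ ^ N) :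
    (Valued.v z ≤ Valued.v x ∧ d ≤ N ∧ N % 2 = d % 2 ∧ Valued.v z / Valued.v x = Valued.v ϖ ^ (N - d)) ∨
      (Valued.v x < Valued.v z ∧ N + 1 = d) := by
  have hϖ := hD.2.2.1
  have heven := hD.2.2.2.1
  rcases le_or_gt (Valued.v z) (Valued.v x) with hzx | hxz
  · left
    have hx0 : x ≠ 0 := fun hx0 => by
      rw [hx0, map_zero] at hzx
      exact hz0 ((Valuation.zero_iff _).1 (le_antisymm hzx zero_le))
    -- `|z| ∕ |x| = |ϖ|^{2m}` for some `m ∈ ℕ`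
    obtain ⟨a, ha⟩ := heven x hx hx0
    obtain ⟨c, hc⟩ := heven z hz hz0
    have hca : c ≤ a := by
      rw [ha, hc] at hzx
      have := WithZero.exp_le_exp.1 hzx
      omega
    have hquot : Valued.v z / Valued.v x = Valued.v ϖ ^ (2 * (a - c).toNat) := by
      rw [ha, hc, valuation_pow_eq_exp hϖ, ← WithZero.exp_sub]
      congr 1
      push_cast
      rw [Int.toNat_of_nonneg (by omega)]
      ring
    have hval := valuation_eigen_sub_eq_of_le hD hx hz hx0 hzx he₂ hratio
    rw [hN, hquot, ← pow_add] at hval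
    have hNe := eq_of_valuation_pow_eq hϖ hval
    refine ⟨hzx, by omega, by omega, ?_⟩
    rw [hquot]
    congr 1
    omega
  · right
    have hval := valuation_eigen_sub_eq_pow_of_lt hD hx hz hxz he₂ hratio
    rw [hN] at hval
    have := eq_of_valuation_pow_eq hϖ hval
    have hd1 := hD.2.2.2.2.2.1
    exact ⟨hxz, by omega⟩

/-- **`d ≤ N ⇒` VERTEX TYPE** (the rows of the census have `n₃ ≥ N₀ = depthOfRecord d ≥ d`, so every row element is of vertex type and its H-side
count is an edge-ball of radius `(N − d)∕2`). [cite: LabesseLanglands1979, §2 p. 8] [cite: Rogawski1990, §4.9 Prop. 4.9.1 p. 55] -/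
theorem valuation_le_of_le_depth (hD : IsRamifiedQuadraticDatum σ ϖ d t) {x z e₁ e₂ : K} (hx : σ x = x) (hz : σ z = z) (hz0 : z ≠ 0)
    (he₂ : Valued.v e₂ = 1) (hratio : e₁ * σ (x + z * ϖ) = e₂ * (x + z * ϖ)) {N : ℕ} (hN : Valued.v (e₁ - e₂) = Valued.v ϖ ^ N)
    (hdN : d ≤ N) : Valued.v z ≤ Valued.v x ∧ Valued.v z / Valued.v x = Valued.v ϖ ^ (N - d) := by
  rcases depth_dichotomy hD hx hz hz0 he₂ hratio hN with ⟨hzx, -, -, hq⟩ | ⟨-, hNd⟩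
  · exact ⟨hzx, hq⟩
  · omega

end Summit.HodgeConjecture.HodgeConjecture.Cruxes.H413.F0P3cDyRamTypeOneDepthLaw

end
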